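import Literature.Probability.Percolation.SlabRSWProp39
import HarnessLib

/-!
# Newman–Tassion–Wu 2017, §3.3 / Theorem 3.10 (3.65): LINEAR one-block extension of a long
# crossing — `f(R ∪ short block) ≥ κ · f(R)` with `κ` independent of the length of `R`

Topic: `Literature/Probability/Percolation`. Tenth file of the port of THEOREM 3.10 of
Newman–Tassion–Wu, *Critical percolation and the minimal spanning tree in slabs* (CPAM 70 (2017);
arXiv:1512.09107).  Printed claim (3.65), p. 12: "for every `λ > 0` there exists a constant
`c₁ = c₁(c) > 0` such that `P[B(S₁') ⟷^{S₁'} R(S₁')] ≥ c₁ P[B(S₁) ⟷^{S₁} R(S₁)]`.  This inequality can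
be obtained by performing several gluing procedures similar to those used in the proof of
Proposition 3.9, and for these gluing procedures we use Remark 3 after Theorem 3.7" (`h₀(x) ≥ c₀x`:
the extension of a long crossing by a BOUNDED block costs a constant factor NOT depending on the
length).  The tree's `NTW17.prop39_one_step` / `prop39_ind_step` (p2) glue the long crossing to its
mirror image and are therefore quadratic in it; this file runs the same three steps with UNEQUAL
pieces — the long box `R = [0, n+M] × [0, n]` and the short box `[0, n+m] × [0, n]` reflected onto
`Q = [-m, n] × [0, n]` — and obtains a bound LINEAR in `f(R)`:

* `real_step12` — steps (1)–(2) of the proof of Prop. 3.9 for a box `[0, n+M'] × [0,n]`: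
  `(1 - √(1 - f(S))) · f([0,n+M']) ≤ K₁ · P[R ⟷ X]` (`S = [0,n]²`, `X = [0,h] × {0}`).
* **`real_lr_extend_linear`** — `(1 - √(1 - f(S)))² · f([0,n+m]) · f([0,n+M]) ≤ K₁² K₂ · f([-m,n+M])`:
  with `f(S), f([0,n+m]) ≥ const(c)` (short boxes) this is `f(R') ≥ κ f(R)`, `κ` free of `M`.

## Sources

* C. M. Newman, V. Tassion, W. Wu, *Critical percolation and the minimal spanning tree in slabs*,
  Comm. Pure Appl. Math. 70 (2017) 2084–2120, arXiv:1512.09107: §3.3, proof of Proposition 3.9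
  ((3.61)–(3.64)) and (3.65) with Remark 3 after Theorem 3.7 [NewmanTassionWu2017].
-/

noncomputable section

namespace Literature.Probability.Percolation

open MeasureTheory LatticeModels
open scoped LatticeModels

namespace NTW17

variable {k : ℕ}

/-- **Steps (1)–(2) of the proof of Prop. 3.9 with the square's own crossing probability**: in
`R = [0, n+M'] × [0, n]` with left-end square `S = [0,n]²` and `X = [0,h] × {0}`,
`(1 - √(1 - P[L ⟷ R in S])) · P[L ⟷ R in R] ≤ K₁ · P[R(R) ⟷^R X]` (half-side square-root trick,
then GL0 with the long crossing). [cite: NewmanTassionWu2017, §3.3 (proof of Proposition 3.9, (3.61)–(3.63))] -/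
theorem real_step12 (hk : 1 ≤ k) {ρ : ℕ} (hρ : 4 ≤ ρ) {n M' h : ℤ} (hh : 2 ≤ h)
    (hn : 2 * h ≤ n) (hn' : n ≤ 2 * h + 1) (hM' : 0 ≤ M') (hsep : h + 4 * ρ + 8 < n + M')
    (p : unitInterval) (hp0 : 0 < (p : ℝ)) (hp1 : (p : ℝ) < 1) :
    (1 - Real.sqrt (1 - (bondPercolation (slabGraph 3 k) p).real
        (slabConn k (boxR 0 n 0 n) {z | z.1 = 0} {z | z.1 = n}))) *
        (bondPercolation (slabGraph 3 k) p).real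
          (slabConn k (boxR 0 (n + M') 0 n) {z | z.1 = 0} {z | z.1 = n + M'}) ≤
      (1 + (2 / min (p : ℝ) (1 - p)) ^ (3 * ((5 * k + 4) * (2 * (6 * ρ + 4) + 1) ^ 2))) *
        (bondPercolation (slabGraph 3 k) p).real
          (slabConn k (boxR 0 (n + M') 0 n) {z | z ∈ boxR 0 (n + M') 0 n ∧ z.1 = n + M'}
            {z | z.2 = 0 ∧ 0 ≤ z.1 ∧ z.1 ≤ h}) := by
  set P := bondPercolation (slabGraph 3 k) p with hP
  set R := boxR 0 (n + M') 0 n with hRdef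
  set S := boxR 0 n 0 n with hSdef
  set X : Set (ℤ × ℤ) := {z | z.2 = 0 ∧ 0 ≤ z.1 ∧ z.1 ≤ h} with hXdef
  set fS := P.real (slabConn k S {z | z.1 = 0} {z | z.1 = n}) with hfS
  set f₁ := P.real (slabConn k R {z | z.1 = 0} {z | z.1 = n + M'}) with hf₁
  have hfS1 : fS ≤ 1 := measureReal_le_one
  -- step 1: the half-side square-root trick in `S`
  have h1 : 1 - Real.sqrt (1 - fS) ≤ P.real (slabConn k R X {z | z ∈ R ∧ z.2 = n}) := by
    have hsq := real_halfBottom_top_ge (k := k) (a := 0) (b := n) (c := 0) (d := n) (m := h) (by omega) p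
    have hbt : P.real (slabConn k S {z | z.2 = 0} {z | z.2 = n}) = fS := real_bt_eq_lr 0 n 0 n p
    have hmono : P.real (slabConn k S {z | z.2 = 0 ∧ 0 ≤ z.1 ∧ z.1 ≤ h} {z | z.2 = n}) ≤
        P.real (slabConn k R X {z | z ∈ R ∧ z.2 = n}) := by
      refine measureReal_mono (fun ω hω => ?_)
      refine slabConn_mono_sets (B := R) subset_rfl subset_rfl (fun z hz => hz) ?_
      refine slabConn_subset_inter_target ?_
      exact slabConn_mono_sets (fun z hz => by rw [hSdef, mem_boxR_iff] at hz; rw [hRdef, mem_boxR_iff]; omega)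
        subset_rfl subset_rfl hω
    calc 1 - Real.sqrt (1 - fS) = 1 - Real.sqrt (1 - P.real (slabConn k S {z | z.2 = 0} {z | z.2 = n})) := by
          rw [hbt]
      _ ≤ _ := hsq
      _ ≤ _ := hmono
  -- step 2: GL0 in `R`, target the top side, glued to `R(R) ⟷ L(R)`
  have hgl := glueLinear_rect_top' (k := k) (a := 0) (b := n + M') (c := 0) (d := n) (by omega) (by omega)
    (A := X) (C := {z | z ∈ R ∧ z.1 = n + M'}) (Dd := {z | z.1 = 0})
    (fun z hz => ⟨by rw [mem_boxR_iff]; simp only [hXdef, Set.mem_setOf_eq] at hz; omega, hz.1⟩)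
    (fun z hz => ⟨hz.1, hz.2⟩) (fun z hz => hz) hk (ρ := ρ) (by omega)
    (fun a' ha' c' hc' hmem => by
      simp only [hXdef, Set.mem_setOf_eq] at ha'
      have h1 := hc'.2
      rw [mem_sqBox_iff'] at hmem
      push_cast at hmem
      omega)
    p hp0 hp1
  have hCD : f₁ ≤ P.real (slabConn k R {z | z ∈ R ∧ z.1 = n + M'} {z | z.1 = 0}) := by
    refine measureReal_mono (fun ω hω => ?_)
    exact slabConn_subset_inter_source (slabConn_comm hω)
  have h0 : 0 ≤ 1 - Real.sqrt (1 - fS) := by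
    rw [sub_nonneg, Real.sqrt_le_one]; linarith [(measureReal_nonneg : 0 ≤ fS)]
  calc (1 - Real.sqrt (1 - fS)) * f₁
      ≤ P.real (slabConn k R X {z | z ∈ R ∧ z.2 = n}) *
          P.real (slabConn k R {z | z ∈ R ∧ z.1 = n + M'} {z | z.1 = 0}) := by gcongr
    _ ≤ _ := hgl

/-- **Linear one-block extension of a long crossing** (NTW (3.65) via (3.61)–(3.64) with unequal
pieces).  Rows `[0, n]`, `2h ≤ n ≤ 2h+1`, `h ≥ 2`, `ρ ≥ 4`, `k ≥ 1`; a long box `R = [0, n+M] × [0,n]`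
and a short extension by `m` columns on the left (`R' = [-m, n+M] × [0,n]`), with
`h + 4ρ + 8 < n + M` and `h + 4ρ + 8 < n + m`.  Then
`(1 - √(1 - f(S)))² · f([0,n+m]) · f([0,n+M]) ≤ K₁² K₂ · f([-m, n+M])`
(`S = [0,n]²`; `K₁, K₂` the GL0 constants): the extended crossing is at least a constant times the
long one, the constant involving only the crossing probabilities of the square and of the SHORT box.
[cite: NewmanTassionWu2017, Theorem 3.10 (proof, (3.65)) and §3.3 (proof of Proposition 3.9)] -/
theorem real_lr_extend_linear (hk : 1 ≤ k) {ρ : ℕ} (hρ : 4 ≤ ρ) {n m M h : ℤ} (hh : 2 ≤ h)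
    (hn : 2 * h ≤ n) (hn' : n ≤ 2 * h + 1) (hm : 0 ≤ m) (hM : 0 ≤ M) (hsepM : h + 4 * ρ + 8 < n + M)
    (hsepm : h + 4 * ρ + 8 < n + m)
    (p : unitInterval) (hp0 : 0 < (p : ℝ)) (hp1 : (p : ℝ) < 1) :
    (1 - Real.sqrt (1 - (bondPercolation (slabGraph 3 k) p).real
        (slabConn k (boxR 0 n 0 n) {z | z.1 = 0} {z | z.1 = n}))) ^ 2 *
        (bondPercolation (slabGraph 3 k) p).real
          (slabConn k (boxR 0 (n + m) 0 n) {z | z.1 = 0} {z | z.1 = n + m}) *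
        (bondPercolation (slabGraph 3 k) p).real
          (slabConn k (boxR 0 (n + M) 0 n) {z | z.1 = 0} {z | z.1 = n + M}) ≤
      (1 + (2 / min (p : ℝ) (1 - p)) ^ (3 * ((5 * k + 4) * (2 * (6 * ρ + 4) + 1) ^ 2))) ^ 2 *
        (1 + (2 / min (p : ℝ) (1 - p)) ^ (3 * ((5 * k + 4) * (2 * (2 * (3 * ρ + 3)) + 1) ^ 2))) *
        (bondPercolation (slabGraph 3 k) p).real
          (slabConn k (boxR (-m) (n + M) 0 n) {z | z.1 = -m} {z | z.1 = n + M}) := by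
  set P := bondPercolation (slabGraph 3 k) p with hP
  set K₁ : ℝ := 1 + (2 / min (p : ℝ) (1 - p)) ^ (3 * ((5 * k + 4) * (2 * (6 * ρ + 4) + 1) ^ 2)) with hK₁
  set K₂ : ℝ := 1 + (2 / min (p : ℝ) (1 - p)) ^ (3 * ((5 * k + 4) * (2 * (2 * (3 * ρ + 3)) + 1) ^ 2))
    with hK₂
  have hK₁pos : 0 < K₁ := by positivity
  have hK₂pos : 0 < K₂ := by positivity
  set R := boxR 0 (n + M) 0 n with hRdef
  set Rm := boxR 0 (n + m) 0 n with hRmdef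
  set Q := boxR (-m) n 0 n with hQdef
  set R' := boxR (-m) (n + M) 0 n with hR'def
  set X : Set (ℤ × ℤ) := {z | z.2 = 0 ∧ 0 ≤ z.1 ∧ z.1 ≤ h} with hXdef
  set Y : Set (ℤ × ℤ) := {z | z.2 = 0 ∧ h ≤ z.1 ∧ z.1 ≤ n} with hYdef
  set gS := 1 - Real.sqrt (1 - P.real (slabConn k (boxR 0 n 0 n) {z | z.1 = 0} {z | z.1 = n})) with hgS
  set fm := P.real (slabConn k Rm {z | z.1 = 0} {z | z.1 = n + m}) with hfm
  set fM := P.real (slabConn k R {z | z.1 = 0} {z | z.1 = n + M}) with hfM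
  set f₂ := P.real (slabConn k R' {z | z.1 = -m} {z | z.1 = n + M}) with hf₂
  have hgS0 : 0 ≤ gS := by
    rw [hgS, sub_nonneg, Real.sqrt_le_one]; linarith [(measureReal_nonneg : 0 ≤ P.real
      (slabConn k (boxR 0 n 0 n) {z | z.1 = 0} {z | z.1 = n}))]
  -- steps 1-2 for the long box and for the short box
  have hlong : gS * fM ≤ K₁ * P.real (slabConn k R {z | z ∈ R ∧ z.1 = n + M} X) :=
    real_step12 hk hρ hh hn hn' hM hsepM p hp0 hp1
  have hshort : gS * fm ≤ K₁ * P.real (slabConn k Rm {z | z ∈ Rm ∧ z.1 = n + m} X) :=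
    real_step12 hk hρ hh hn hn' hm hsepm p hp0 hp1
  -- reflect the short box onto `Q = [-m, n] × [0, n]`
  have hrefl : P.real (slabConn k Rm {z | z ∈ Rm ∧ z.1 = n + m} X) =
      P.real (slabConn k Q {z | z ∈ Q ∧ z.1 = -m} {z | z.2 = 0 ∧ n - h ≤ z.1 ∧ z.1 ≤ n}) := by
    have hg := planarAdj_planarReflect n
    have hQ' : planarReflect n '' Rm = Q := by
      rw [image_planarReflect_eq]; ext z
      simp only [Set.mem_setOf_eq, hRmdef, hQdef, mem_boxR_iff]; omega
    have hA' : planarReflect n '' {z | z ∈ Rm ∧ z.1 = n + m} = {z | z ∈ Q ∧ z.1 = -m} := by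
      rw [image_planarReflect_eq]; ext z
      simp only [Set.mem_setOf_eq, hRmdef, hQdef, mem_boxR_iff]; omega
    have hX' : planarReflect n '' X = {z | z.2 = 0 ∧ n - h ≤ z.1 ∧ z.1 ≤ n} := by
      rw [image_planarReflect_eq]; ext z
      simp only [Set.mem_setOf_eq, hXdef]; omega
    have heq := real_slabConn_image k (planarReflect n) hg p Rm {z | z ∈ Rm ∧ z.1 = n + m} X
    rw [hQ', hA', hX'] at heq
    exact heq.symm
  -- step 3: interleaved GL0 in `R'`
  have hgl := glueLinear_seg_bottom_sides (k := k) (a := -m) (b := n + M) (c := 0) (d := n) (x₁ := 0)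
    (x₂ := h) (by omega) (by omega) (by omega) (by omega) (by omega)
    (A := {z | z ∈ R' ∧ z.1 = n + M}) (C := {z | z ∈ R' ∧ z.1 = -m}) (Y := Y)
    (fun z hz => hz) (fun z hz => hz) (fun z hz => ⟨hz.1, hz.2.1⟩) hk hρ
    (fun a' ha' c' hc' hmem => by
      have h1 := ha'.2; have h2 := hc'.2
      rw [mem_sqBox_iff'] at hmem
      push_cast at hmem
      omega)
    p hp0 hp1
  -- monotonicity: from `R` and `Q` to `R'`
  have hRR' : P.real (slabConn k R {z | z ∈ R ∧ z.1 = n + M} X) ≤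
      P.real (slabConn k R' {z | z ∈ R' ∧ z.1 = n + M} {z | z.2 = 0 ∧ 0 ≤ z.1 ∧ z.1 ≤ h}) := by
    have hsub : R ⊆ R' := fun z hz => by
      rw [hRdef, mem_boxR_iff] at hz; rw [hR'def, mem_boxR_iff]; omega
    exact measureReal_mono (slabConn_mono_sets hsub (fun z hz => ⟨hsub hz.1, hz.2⟩) subset_rfl)
  have hQR' : P.real (slabConn k Q {z | z ∈ Q ∧ z.1 = -m} {z | z.2 = 0 ∧ n - h ≤ z.1 ∧ z.1 ≤ n}) ≤
      P.real (slabConn k R' {z | z ∈ R' ∧ z.1 = -m} Y) := by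
    have hsub : Q ⊆ R' := fun z hz => by
      rw [hQdef, mem_boxR_iff] at hz; rw [hR'def, mem_boxR_iff]; omega
    refine measureReal_mono (slabConn_mono_sets hsub (fun z hz => ⟨hsub hz.1, hz.2⟩) fun z hz => ?_)
    simp only [Set.mem_setOf_eq, hYdef] at hz ⊢; omega
  -- assemble
  have hf2' : P.real (slabConn k R' {z | z ∈ R' ∧ z.1 = -m} {z | z ∈ R' ∧ z.1 = n + M}) ≤ f₂ :=
    measureReal_mono (slabConn_mono_sets subset_rfl (fun z hz => hz.2) (fun z hz => hz.2))
  have hu : gS * fM ≤ K₁ * P.real (slabConn k R' {z | z ∈ R' ∧ z.1 = n + M} {z | z.2 = 0 ∧ 0 ≤ z.1 ∧ z.1 ≤ h}) :=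
    hlong.trans (by gcongr)
  have hv : gS * fm ≤ K₁ * P.real (slabConn k R' {z | z ∈ R' ∧ z.1 = -m} Y) := by
    rw [hrefl] at hshort; exact hshort.trans (by gcongr)
  have hfm0 : 0 ≤ fm := measureReal_nonneg
  have hfM0 : 0 ≤ fM := measureReal_nonneg
  set u := P.real (slabConn k R' {z | z ∈ R' ∧ z.1 = n + M} {z | z.2 = 0 ∧ 0 ≤ z.1 ∧ z.1 ≤ h}) with hudef
  set v := P.real (slabConn k R' {z | z ∈ R' ∧ z.1 = -m} Y) with hvdef
  set w := P.real (slabConn k R' {z | z ∈ R' ∧ z.1 = -m} {z | z ∈ R' ∧ z.1 = n + M}) with hwdef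
  have hprod : (gS * fm) * (gS * fM) ≤ (K₁ * v) * (K₁ * u) :=
    mul_le_mul hv hu (mul_nonneg hgS0 hfM0) (by positivity)
  have hsq : gS ^ 2 * fm * fM = (gS * fm) * (gS * fM) := by ring
  have hK : (K₁ * v) * (K₁ * u) = K₁ ^ 2 * (u * v) := by
    rw [mul_mul_mul_comm, ← sq, mul_comm v u]
  rw [hsq]
  calc (gS * fm) * (gS * fM) ≤ (K₁ * v) * (K₁ * u) := hprod
    _ = K₁ ^ 2 * (u * v) := hK
    _ ≤ K₁ ^ 2 * (K₂ * w) := by gcongr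
    _ ≤ K₁ ^ 2 * (K₂ * f₂) := by gcongr
    _ = K₁ ^ 2 * K₂ * f₂ := (mul_assoc _ _ _).symm

end NTW17

end Literature.Probability.Percolation

end
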